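import Literature.Analysis.FluidPDE.ClassicalNSBlowupAlternative
import Literature.Analysis.FluidPDE.NSForcedH1ContinuationOfLocalExistence
import Literature.Analysis.FluidPDE.TaoH1LocalExistenceForcedHolds
import HarnessLib

/-!
# Restart of a classical solution of the FORCED Navier–Stokes system on `ℝ³` (Clay-class force)
# past the end of a half-open slab, under a uniform `H¹` bound

Analysis/FluidPDE **proofs file** (theorems only: no definitions, no named facts). The restart step of
the forced blow-up alternative (`ForcedClassicalBlowupAlternative.lean`, the forced twin of the tree's
`finiteEnergy_classical_dichotomy` / `bkmClass_dichotomy`), for `ν > 0` and a force `f` smooth on the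
closed half-space `[0,∞) × ℝ³` with Fefferman's space–time decay (`IsSmoothOnHalfSpace f`,
`HasRapidSpaceTimeDecay f`). The class is Tao's `L^∞_t H^k_x` for every `k`
(`HasBoundedSobolevNormsOn`, the class of `tao2011_smooth_local_existence_forced`).

* `exists_forced_sobolevClass_Icc_of_sobolevDatum` — forced local existence in the class on SOME
  closed slab from a smooth divergence-free `H^∞` datum (the discharged
  `tao2011_smooth_local_existence_forced_holds` with the `H¹` sizes of datum and force and a step from
  `TaoForcedHC.exists_small_step`).
* `exists_forced_Icc_extension_of_H1_bound` — **restart under a uniform `H¹` bound**: a classical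
  solution with force `f` on `[0, T) × ℝ³`, `T > 0`, in the class on every closed sub-slab and with
  `∫|u(t)|² + ∫|∇u(t)|²_F ≤ A` for `t < T`, extends to a classical solution on a CLOSED slab `[0, T']`,
  `T' > T`, in the class, equal to `u` on `[0, T)` (Lemarié-Rieusset 2016, proof of Thm. 7.2; Tao
  2013, Thm. 5.4 (ii)+(iv) with force): with `B` the `H¹` size of the slices of `f`
  (`TaoForcedHC.exists_H1_bound_force`) and a step `h > 0` with `(√A + B h)⁴ h ≤ c ν³`
  (`TaoForcedHC.exists_small_step`), restart the forced local existence theorem at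
  `s = max(T/2, T − h/2)` from the `H^∞` slice `u(s)` with the shifted force `f(· + s)`
  (`ClayForceTimeShift`); the local solution is the shifted flow on `[0, T − s)` by uniqueness with
  bounded Sobolev norms (`IsClassicalNSSolutionOn.velocity_eq_of_hasBoundedSobolevNormsOn`, valid WITH
  force); shift back and glue along the open overlap (`IsClassicalNSSolutionOn.glue`), switching at
  `(s + T)/2` so that the class bounds of both pieces are available on the glued closed slab. The same
  restart as in `lemarieRieusset2016_H1_continuation_forced_of_smooth_local_existence`
  (`NSForcedH1ContinuationOfLocalExistence.lean`), but with a CLOSED-slab, in-class conclusion and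
  without the finite-energy / `∂ₜu` hypotheses of that named fact.
* `exists_forced_sobolevClass_Icc_extension` — the closed-slab corollary: the class is open to the
  right (forced twin of `exists_bkmClass_Icc_extension`, `ν > 0`).

## References

* P. G. Lemarié-Rieusset, *The Navier–Stokes Problem in the 21st Century*, CRC Press 2016, Thm. 7.2
  and its proof (restart in uniform steps), Thm. 7.3. [LemarieRieusset2016]
* T. Tao, *Localisation and compactness properties of the Navier–Stokes global regularity problem*,
  Anal. PDE 6 (2013) = arXiv:1108.1165, Thm. 5.4 (ii)+(iv) (arXiv Thm. 31) with force. [Tao2011]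
* J. C. Robinson, J. L. Rodrigo, W. Sadowski, *The Three-Dimensional Navier–Stokes Equations*, CUP
  2016, §8.1 (restart–identify–glue). [RobinsonRodrigoSadowski2016]

WHAT THIS IS NOT: not a claim about NS regularity or blow-up; not a claim about any author beyond the
typed locator.
-/
noncomputable section

open MeasureTheory Set Function Filter Topology
open scoped ENNReal NNReal ContDiff

namespace Literature.Analysis.FluidPDE

variable {ν : ℝ} {f : ℝ → EuclideanSpace ℝ (Fin 3) → EuclideanSpace ℝ (Fin 3)}
  {u₀ : EuclideanSpace ℝ (Fin 3) → EuclideanSpace ℝ (Fin 3)}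

/-! ## Plumbing: the `H¹` size from the class bounds -/

/-- In the class `L^∞_t H^k_x` on a time set `S` the `H¹` size `∫|u(t)|² + ∫|∇u(t)|²_F` is bounded
on `S` (by the `n = 0` bound plus three times the `n = 1` bound). [folklore] -/
private theorem HasBoundedSobolevNormsOn.exists_H1_bound {S : Set ℝ}
    {u : ℝ → EuclideanSpace ℝ (Fin 3) → EuclideanSpace ℝ (Fin 3)} (hB : HasBoundedSobolevNormsOn S u) :
    ∃ A : ℝ≥0, ∀ t ∈ S, (∫⁻ x, ‖u t x‖ₑ ^ 2) +
      (∫⁻ x, ENNReal.ofReal (frobeniusNormSq (fderiv ℝ (u t) x))) ≤ A := by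
  obtain ⟨C₀, hC₀⟩ := hB 0
  obtain ⟨C₁, hC₁⟩ := hB 1
  refine ⟨C₀ + 3 * C₁, fun t ht => ?_⟩
  push_cast
  refine add_le_add ?_ ?_
  · rw [lintegral_enorm_sq_eq_lintegral_iteratedFDeriv_zero]
    exact hC₀ t ht
  · exact (lintegral_frobeniusNormSq_le_three_mul (u t)).trans (by gcongr; exact hC₁ t ht)

/-! ## Local existence from an `H^∞` datum (the forced local theorem, some closed slab) -/

/-- **Forced local existence in the class** (Tao 2013, Thm. 5.4 (ii)+(iv) with force, the tree's
discharged `tao2011_smooth_local_existence_forced_holds`, on SOME closed slab): for `ν > 0`, a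
Clay-class force and a smooth divergence-free datum with all derivatives in `L²`, some `[0, T₀]`,
`T₀ > 0`, carries a classical solution of the forced system from `u₀` with all `L²` Sobolev norms
bounded on `[0, T₀]`. [cite: Tao2011, Thm. 5.4 (ii)+(iv) (arXiv Thm. 31)] -/
theorem exists_forced_sobolevClass_Icc_of_sobolevDatum (hν : 0 < ν)
    (hfs : IsSmoothOnHalfSpace f) (hfd : HasRapidSpaceTimeDecay f) (hu₀ : ContDiff ℝ ∞ u₀)
    (hdiv : VectorCalculus.IsDivFree u₀) (hH : ∀ n : ℕ, ∫⁻ x, ‖iteratedFDeriv ℝ n u₀ x‖ₑ ^ 2 < ⊤) :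
    ∃ T₀ : ℝ, 0 < T₀ ∧
      ∃ (u : ℝ → EuclideanSpace ℝ (Fin 3) → EuclideanSpace ℝ (Fin 3))
        (p : ℝ → EuclideanSpace ℝ (Fin 3) → ℝ),
        IsClassicalNSSolutionOn (Icc 0 T₀) ν f u p ∧ u 0 = u₀ ∧ HasBoundedSobolevNormsOn (Icc 0 T₀) u := by
  obtain ⟨c, hc, hloc⟩ := tao2011_smooth_local_existence_forced_holds
  -- the `H¹` size of the datum
  set Atop : ℝ≥0∞ := (∫⁻ x, ‖u₀ x‖ₑ ^ 2) +
    ∫⁻ x, ENNReal.ofReal (frobeniusNormSq (fderiv ℝ u₀ x)) with hAtop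
  have hAfin : Atop < ⊤ := by
    refine ENNReal.add_lt_top.2 ⟨?_, ?_⟩
    · rw [lintegral_enorm_sq_eq_lintegral_iteratedFDeriv_zero]; exact hH 0
    · exact lt_of_le_of_lt (lintegral_frobeniusNormSq_le_three_mul u₀)
        (ENNReal.mul_lt_top (by simp) (hH 1))
  set A : ℝ := Real.sqrt Atop.toReal with hAdef
  have hA0 : 0 ≤ A := Real.sqrt_nonneg _
  have hAle : Atop ≤ ENNReal.ofReal (A ^ 2) := by
    rw [hAdef, Real.sq_sqrt ENNReal.toReal_nonneg]
    exact (ENNReal.ofReal_toReal hAfin.ne).ge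
  -- the `H¹` size of the force and the lifespan
  obtain ⟨B, hB, hBf⟩ := TaoForcedHC.exists_H1_bound_force hfs hfd
  obtain ⟨T₀, hT₀, hsmall⟩ := TaoForcedHC.exists_small_step hA0 hB hc hν
  obtain ⟨u, p, hcl, hu0, hsob, -, -, -⟩ := hloc hν hT₀ hu₀ hdiv hH
    (hfs.isSmoothSpaceTimeOn_Icc T₀) (hfd.hasUniformRapidDecayOn_Icc hfs hT₀) hA0 hB hAle
    (fun t ht => hBf t ht.1) hsmall
  exact ⟨T₀, hT₀, u, p, hcl, hu0, hsob⟩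

/-! ## Restart under a uniform `H¹` bound: past the end of a half-open slab -/

/-- **Restart under a uniform `H¹` bound** (Lemarié-Rieusset 2016, proof of Thm. 7.2, with force;
Tao 2013, Thm. 5.4 (ii)+(iv)). Let `ν > 0`, `T > 0`, `f` a Clay-class force, and `(u, p)` a classical
solution with force `f` on `[0, T) × ℝ³` with all `L²` Sobolev norms bounded on every closed
sub-slab `[0, T']`, `0 < T' < T`, and `∫|u(t)|² + ∫|∇u(t)|²_F ≤ A` for all `t ∈ [0, T)`. Then there
are `T' > T` and a classical solution `(u', p')` with force `f` on the CLOSED slab `[0, T'] × ℝ³`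
with all Sobolev norms bounded on `[0, T']`, `u' 0 = u 0`, and `u' = u` on `[0, T)`. See the module
docstring for the restart–identify–glue proof.
[cite: LemarieRieusset2016, Thm. 7.2 (proof, p. 125 and PDF p. 147)] [cite: Tao2011, Thm. 5.4 (ii)+(iv) (arXiv Thm. 31)] -/
theorem exists_forced_Icc_extension_of_H1_bound (hν : 0 < ν) {T : ℝ} (hT : 0 < T)
    (hfs : IsSmoothOnHalfSpace f) (hfd : HasRapidSpaceTimeDecay f)
    {u : ℝ → EuclideanSpace ℝ (Fin 3) → EuclideanSpace ℝ (Fin 3)}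
    {p : ℝ → EuclideanSpace ℝ (Fin 3) → ℝ}
    (hsol : IsClassicalNSSolutionOn (Ico 0 T) ν f u p)
    (hB : ∀ T' ∈ Ioo 0 T, HasBoundedSobolevNormsOn (Icc 0 T') u)
    (hA : ∃ A : ℝ≥0, ∀ t ∈ Ico 0 T, (∫⁻ x, ‖u t x‖ₑ ^ 2) +
      (∫⁻ x, ENNReal.ofReal (frobeniusNormSq (fderiv ℝ (u t) x))) ≤ A) :
    ∃ T' : ℝ, T < T' ∧
      ∃ (u' : ℝ → EuclideanSpace ℝ (Fin 3) → EuclideanSpace ℝ (Fin 3))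
        (p' : ℝ → EuclideanSpace ℝ (Fin 3) → ℝ),
        IsClassicalNSSolutionOn (Icc 0 T') ν f u' p' ∧ HasBoundedSobolevNormsOn (Icc 0 T') u' ∧
          u' 0 = u 0 ∧ ∀ t ∈ Ico 0 T, u' t = u t := by
  classical
  obtain ⟨c, hc, hloc⟩ := tao2011_smooth_local_existence_forced_holds
  -- (1) the uniform `H¹` radius as a real number
  obtain ⟨A₀, hA₀⟩ := hA
  set A : ℝ := Real.sqrt (A₀ : ℝ) with hAdef
  have hA0 : 0 ≤ A := Real.sqrt_nonneg _
  have hAu : ∀ t ∈ Ico 0 T, (∫⁻ x, ‖u t x‖ₑ ^ 2) +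
      (∫⁻ x, ENNReal.ofReal (frobeniusNormSq (fderiv ℝ (u t) x))) ≤ ENNReal.ofReal (A ^ 2) := by
    intro t ht
    rw [hAdef, Real.sq_sqrt A₀.coe_nonneg, ENNReal.ofReal_coe_nnreal]
    exact hA₀ t ht
  obtain ⟨B, hB0, hBf⟩ := TaoForcedHC.exists_H1_bound_force hfs hfd
  -- (2) the step and the restart time
  obtain ⟨h, hh, hsmall⟩ := TaoForcedHC.exists_small_step hA0 hB0 hc hν
  set s : ℝ := max (T / 2) (T - h / 2) with hsdef
  have hs0 : 0 < s := lt_of_lt_of_le (by linarith) (le_max_left _ _)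
  have hsT : s < T := max_lt (by linarith) (by linarith)
  have hTs : T - s < h := by
    have : T - h / 2 ≤ s := le_max_right _ _
    linarith
  have hsIco : s ∈ Ico 0 T := ⟨hs0.le, hsT⟩
  -- (3) the forced local theorem from the `H^∞` slice `u s` with the shifted force
  set T₁ : ℝ := (s + T) / 2 with hT₁
  have hT₁mem : T₁ ∈ Ioo 0 T := ⟨by rw [hT₁]; linarith, by rw [hT₁]; linarith⟩
  have hsT₁ : s < T₁ := by rw [hT₁]; linarith
  have hsT₁' : s ∈ Icc 0 T₁ := ⟨hs0.le, hsT₁.le⟩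
  have hHs : ∀ n : ℕ, ∫⁻ x, ‖iteratedFDeriv ℝ n (u s) x‖ₑ ^ 2 < ⊤ := fun n => by
    obtain ⟨C, hC⟩ := hB T₁ hT₁mem n
    exact (hC s hsT₁').trans_lt ENNReal.coe_lt_top
  obtain ⟨v, q, hsol', hv0, hvb, -, -, -⟩ := hloc hν hh (hsol.contDiff_velocity hsIco)
    (hsol.divFree s hsIco) hHs (hfs.isSmoothSpaceTimeOn_Icc_timeShift hs0.le h)
    (hfd.hasUniformRapidDecayOn_Icc_timeShift hfs hs0.le hh) hA0 hB0 (hAu s hsIco)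
    (fun t ht => hBf (t + s) (by linarith [ht.1])) hsmall
  -- (4) identification: `v = u (· + s)` on `[0, T - s)`, by uniqueness on every closed `[0, δ]`
  have heq : ∀ t ∈ Ico 0 (T - s), v t = u (t + s) := by
    intro t ht
    set δ : ℝ := (t + (T - s)) / 2 with hδ
    have hδ0 : 0 < δ := by rw [hδ]; linarith [ht.1, ht.2]
    have htδ : t ∈ Icc 0 δ := ⟨ht.1, by rw [hδ]; linarith [ht.2]⟩
    have hδT : s + δ < T := by rw [hδ]; linarith [ht.2]
    have hδh : δ ≤ h := by rw [hδ]; linarith [ht.2]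
    have hshift : IsClassicalNSSolutionOn (Icc 0 δ) ν (fun r => f (r + s)) (fun r => u (r + s))
        (fun r => p (r + s)) :=
      (hsol.comp_add_right s).mono
        (fun r hr => show r + s ∈ Ico 0 T from ⟨by linarith [hr.1], by linarith [hr.2]⟩)
        (uniqueDiffOn_Icc hδ0)
    have hBshift : HasBoundedSobolevNormsOn (Icc 0 δ) (fun r => u (r + s)) := by
      intro n
      obtain ⟨C, hC⟩ := hB (s + δ) ⟨by linarith, hδT⟩ n
      exact ⟨C, fun r hr => hC (r + s) ⟨by linarith [hr.1], by linarith [hr.2]⟩⟩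
    have hsolδ : IsClassicalNSSolutionOn (Icc 0 δ) ν (fun r => f (r + s)) v q :=
      hsol'.mono (Icc_subset_Icc_right hδh) (uniqueDiffOn_Icc hδ0)
    have h0 : (fun r => u (r + s)) 0 = v 0 := by simp [hv0]
    exact (hshift.velocity_eq_of_hasBoundedSobolevNormsOn hsolδ hν.le hδ0 hBshift
      (hvb.mono (Icc_subset_Icc_right hδh)) h0 t htδ).symm
  -- (5) shift the local solution back by `-s` and glue along the open overlap `(s, T₁)`
  have hv' := hsol'.comp_add_right (-s)
  have hf : (fun t => f (t + -s + s)) = f := by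
    funext t
    rw [neg_add_cancel_right]
  rw [hf] at hv'
  have h₂ : IsClassicalNSSolutionOn (Ioo s (s + h)) ν f (fun t => v (t + -s)) (fun t => q (t + -s)) :=
    hv'.mono (fun t ht => show t + -s ∈ Icc 0 h from ⟨by linarith [ht.1], by linarith [ht.2]⟩)
      isOpen_Ioo.uniqueDiffOn
  have h₁ : IsClassicalNSSolutionOn (Ico 0 T₁) ν f u p :=
    hsol.mono (fun t ht => ⟨ht.1, ht.2.trans hT₁mem.2⟩) (uniqueDiffOn_Ico 0 T₁)
  have heq' : ∀ t ∈ Ioo s T₁, u t = v (t + -s) := by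
    intro t ht
    rw [heq (t + -s) ⟨by linarith [ht.1], by linarith [ht.2, hT₁mem.2]⟩, neg_add_cancel_right]
  have hT₁b : T₁ ≤ s + h := by linarith [hT₁mem.2]
  have hglue := h₁.glue h₂ hs0.le hsT₁ hT₁b heq'
  -- (6) the longer closed slab `[0, T']`, `T' = (T + (s + h))/2 ∈ (T, s + h)`
  set T' : ℝ := (T + (s + h)) / 2 with hT'
  have hTT' : T < T' := by rw [hT']; linarith
  have hT'b : T' < s + h := by rw [hT']; linarith
  have hT'0 : 0 < T' := hT.trans hTT'
  refine ⟨T', hTT', _, _, hglue.mono (Icc_subset_Ico_right hT'b) (uniqueDiffOn_Icc hT'0), ?_, ?_, ?_⟩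
  · -- Sobolev norms on `[0, T']`: those of `u` on `[0, T₁]` and of `v` on `[0, h]`
    intro n
    obtain ⟨C₁, hC₁⟩ := hB T₁ hT₁mem n
    obtain ⟨C₂, hC₂⟩ := hvb n
    refine ⟨max C₁ C₂, fun t ht => ?_⟩
    by_cases htT : t < T₁
    · simp only [if_pos htT]
      exact (hC₁ t ⟨ht.1, htT.le⟩).trans (ENNReal.coe_le_coe.2 (le_max_left _ _))
    · simp only [if_neg htT]
      have hTt : T₁ ≤ t := not_lt.1 htT
      exact (hC₂ (t + -s) ⟨by linarith, by linarith [ht.2]⟩).trans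
        (ENNReal.coe_le_coe.2 (le_max_right _ _))
  · simp only [if_pos hT₁mem.1]
  · intro t ht
    by_cases htT : t < T₁
    · simp only [if_pos htT]
    · simp only [if_neg htT]
      have hTt : T₁ ≤ t := not_lt.1 htT
      rw [heq (t + -s) ⟨by linarith, by linarith [ht.2]⟩, neg_add_cancel_right]

/-- **Restart from a closed slab** (the class is open to the right): a classical solution of the
forced system on `[0, T] × ℝ³`, `T > 0`, with all Sobolev norms bounded on `[0, T]` extends to a
classical solution on a longer closed slab `[0, T']`, `T' > T`, in the class, equal to `u` before `T`
and with the same initial slice (`exists_forced_Icc_extension_of_H1_bound` with the `H¹` bound read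
off the class bounds). Forced twin of `exists_bkmClass_Icc_extension` (`ν > 0`).
[cite: LemarieRieusset2016, Thm. 7.2 (proof, p. 125)] [cite: Tao2011, Thm. 5.4 (ii)+(iv)] -/
theorem exists_forced_sobolevClass_Icc_extension (hν : 0 < ν) {T : ℝ} (hT : 0 < T)
    (hfs : IsSmoothOnHalfSpace f) (hfd : HasRapidSpaceTimeDecay f)
    {u : ℝ → EuclideanSpace ℝ (Fin 3) → EuclideanSpace ℝ (Fin 3)}
    {p : ℝ → EuclideanSpace ℝ (Fin 3) → ℝ}
    (hsol : IsClassicalNSSolutionOn (Icc 0 T) ν f u p) (hB : HasBoundedSobolevNormsOn (Icc 0 T) u) :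
    ∃ T' : ℝ, T < T' ∧
      ∃ (u' : ℝ → EuclideanSpace ℝ (Fin 3) → EuclideanSpace ℝ (Fin 3))
        (p' : ℝ → EuclideanSpace ℝ (Fin 3) → ℝ),
        IsClassicalNSSolutionOn (Icc 0 T') ν f u' p' ∧ HasBoundedSobolevNormsOn (Icc 0 T') u' ∧
          u' 0 = u 0 ∧ ∀ t ∈ Ico 0 T, u' t = u t := by
  obtain ⟨A, hA⟩ := hB.exists_H1_bound
  exact exists_forced_Icc_extension_of_H1_bound hν hT hfs hfd
    (hsol.mono Ico_subset_Icc_self (uniqueDiffOn_Ico 0 T))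
    (fun T' hT' => hB.mono (Icc_subset_Icc_right hT'.2.le)) ⟨A, fun t ht => hA t (Ico_subset_Icc_self ht)⟩

end Literature.Analysis.FluidPDE

end
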